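import Literature.NumberTheory.EllipticCurves.KatoAdditiveTwistedValueNeronIntegrality
import HarnessLib

/-!
# Kato's integral zeta elements read in NÉRON units at the ADDITIVE prime `p = 2`, for characters of ODD
# order with `χ(8) ≠ 1`, against the FULL real Néron period `Ω(V) = ∫_{V(ℝ)} |ω|` — named fact
# (the real-subfield sharpening of `kato_neron_isIntegral_twistedSymbolSum_of_additive_two_polar`)

Topic `NumberTheory/EllipticCurves`. ONE named fact (`def … : Prop`, D-0014), the sharpened `p = 2` sibling of
`kato_neron_isIntegral_twistedSymbolSum_of_additive_two_polar`
(`KatoAdditiveTwistedValueNeronIntegralityTwo.lean`, referred to below as the POLAR fact): the SAME binders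
VERBATIM, and the conclusion WITHOUT the archimedean factor `#π₀(V(ℝ)) = (if 0 < Δ(V) then 2 else 1)`. The
polar fact is the special case (the deleted factor is a natural number; proved bridge
`kato_neron_isIntegral_twistedSymbolSum_of_additive_two_polar_of_real` in the sibling theorem file
`KatoAdditiveTwistedValueNeronIntegralityTwoRealForms.lean`). Requested by cell `pub/bsd-f2-manin` (analytic /
period-lattice lens MEMO-an §54 «real-subfield halving», row F-an-42 of its CANDIDATES.md; statement VERBATIM
the cell file HOME/an/Sketch-an-g10.lean ec9872d4893aad5d, decl `KatoNeronIsIntegralTwistedSymbolSumOfAdditiveTwoReal`;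
endorsed as the `p = 2` fact text by the Euler-system lens, owner of the polar fact, MEMO-es §24). Consumer: line
`kato-shift-two` (v5 skeleton, stub 1♯) of the deciding crux C2 `ManinOddAtFour`
(stmt-BirchSwinnertonDyer-22967 of route `Summits/BirchSwinnertonDyer/BirchSwinnertonDyer/Theses/ManinLocalTwoThree.lean`).

## The printed statements (first-hand; locators to the held copies; those of the polar fact are not repeated)

* K. Kato, Astérisque 295 (2004) [Kato2004Asterisque] (held `paper:doi-10-24033-ast-639`; PDF page = printed
  page − 115). **§4.5** (p. 144, PDF p0029 L69–74): "Let `ι : V_{k,ℤ}(Y(M,N)) → V_{k,ℤ}(Y(M,N))` be the map induced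
  by the complex conjugation on `Y(M,N)(ℂ)` and on `E(ℂ)` … For an element `x` of `V_{k,ℂ}(Y(M,N))`, let
  `x^± = ½(x ± ι(x))`." **§4.7** (p. 145, PDF p0030 L22–31): `δ_{M,N}(k,j)` is the image of a path class under
  `H₁(X(M,N)(ℂ), {cusps}, Sym) ≅ … ≅ V_{k,ℤ}`, "the first isomorphism is by Poincaré duality". **Thm. 6.6** (p. 163,
  PDF p0048 L12–32): "Let `f`, `S` be as in (5.1.1). Let `χ : (ℤ/m)^× → ℂ^×` be a character." — ANY character, of
  either parity; "(1) For integers `r, r′` satisfying (5.2.3) and for `± = (−1)^{k−r−1}χ(−1)` we have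
  `Σ_{b∈(ℤ/m)^×} χ(b) per_f(σ_b(z_m(f,r,r′,ξ,S)))^± = … L_S(f*, χ, r)·(2πi)^{k−r−1}·δ(f,r′,ξ)^±`"; "Let `r, r′, c, d`
  be integers satisfying (5.2.1) (5.2.2). In the case `ξ ∈ SL₂(ℤ)`, assume `c ≡ d ≡ 1 mod N`. Let
  `± = (−1)^{k−r−1}χ(−1)` …", with `T = (c² − c^uχ̄(c))(d² − d^vχ̄(d))` "in the case `ξ ∈ SL₂(ℤ)`" (BOTH characters barred, as printed — p. 163, second display; the reading `χ(c)` formerly written here was erratum F-UE-1 / docket DD-213, cf. `Kato2004.exists_member_sl2ZetaElement_neron_values_bar`). **Thm. 12.5 (1)**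
  (p. 221, PDF p0106 L43–60): the map `x ⊗ y ↦ Σ_{σ∈G} χ(σ)σ(y)·per_f(x)^±`, "`± = (−1)^{k−r−1}χ(−1)`", sends the
  image of `z_γ^{(p)}` to `(2πi)^{k−r−1}L_{(p)}(f,χ,r)·γ^±`; and "We have `z^{(p)}_{ι(γ)} = σ_{−1}(z^{(p)}_γ)` for all
  `γ ∈ V_{F_λ}(f)`, where `ι : V_{F_λ}(f) → V_{F_λ}(f)` is the action of the complex conjugation." NOT used:
  **Thm. 12.4 (3)** / **12.5 (4)** (pp. 221–222, PDF p0106 L17, p0107 L13–14: "If `p ≠ 2` …", "Assume `p ≠ 2`,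
  and assume (12.5.2)" — freeness statements about `H¹`, not value statements).
* C. Wuthrich, Doc. Math. 19 (2014) [Wuthrich2014] §3 (held `paper:doi-10-4171-dm-450` chunk p0008 L11): "the
  lattice `V_ℤ(f)` is mapped to the image of the relative homology `H₁(X₁(N)(ℂ), {cusps}, ℤ)`. It contains the
  lattice `H₁(E₁(ℂ), ℤ)`."
* D. Bullach, M. Honnor, arXiv:2511.07203 [BullachHonnor2025] (held `paper:arxiv-2511.07203`) — the NEAREST
  PRINT, cited for placement only: §2.1 (chunk p0009 L7–9: "Write `c_∞ ∈ {1, 2}` for the number of connected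
  components of `E(ℝ)`", `Ω⁺ = ∫_{E(ℝ)}ω_E = c_∞·∫_{γ⁺}ω_E`), Rem. 2.1 ("Mazur and Tate use the periods `½Ω⁺` and
  `(c_∞/2)Ω⁻`"), Thm. 2.8 (b) (chunk p0011 L5–6: "If `E[p]` is irreducible … and `E(K)` contains no point of
  order `p`, then `c_∞·y_K^{Kato}` (and hence also `c_∞·z_K^{Kato}`) belongs to `H¹(O_{K,S(K)}, T_pE)`"), (c) (L10:
  `exp*` normalised by `L_{S(K)}(E, χ⁻¹, 1)/Ω^{sgn χ}`), and chunk p0013 L99 ("we have fixed an odd prime `p`").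
  Print keeps the factor `c_∞ = #π₀(E(ℝ))` because it asks for an integral cohomology CLASS; the statement below is
  about VALUES at EVEN characters, which see only the `+`-part, at `p = 2`.
* Everything the polar fact cites (Kato (8.1.2)–(8.1.3) p. 180, Thm. 9.7 p. 189, Thm. 12.6 (2) p. 222, the remark
  after (12.8.1) p. 223; Kosters–Pannekoek arXiv:1703.07888 Thm. 1 (i), Cor. 2 (i), Lemma 7, Lemma 9, Prop. 10,
  §3.3.1 table `p = 2`, Example 13; Kim–Nakamura 2020 §2.1 / Cor. 2.4; Delbourgo 2002 p. 50; Bloch–Kato 1990 §3;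
  Mazur–Tate–Teitelbaum 1986 (I.8.6)) — locators in that module's docstring, unchanged.

## The derivation (the typed statement is its last line)

Notation and steps 1–4 with (Q1)–(Q5) EXACTLY as in the polar fact's module docstring (`V/ℚ` globally minimal,
additive at `2`, `E[2]` irreducible — so every curve of the isogeny class has irreducible `2`-torsion and is
ODD-isogenous to `V` —, newform `f` of level `N`, `(m, 2N) = 1`, `K = ℚ(ζ_m)`, `G = Gal(K/ℚ) ≅ (ℤ/m)^× ∋ σ_b`, `χ`
primitive mod `m`, `χ ≠ 1`, of ODD order (hence EVEN: `χ(−1)² = 1` and `χ(−1)` has odd order), `v ∣ 2`,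
`K_v ≅ ℚ_{2^f}`, `f = ord_m 2`, residue field `k_v`, Frobenius `F`; since `m` is odd, `2` is unramified in `K` and
the decomposition group of EVERY `v ∣ 2` is `D = ⟨σ₂⟩`, cyclic of order `f`, `σ₂ ↦ F`; receptacle
`R_v = M₀,v^∨ = O_v + ½·lift(P_v)`, polar map `π_v : R_v → ½O_v/O_v ≅ k_v`, `π_v(x) = 2x mod 2`, image in
`P_v = ker(1 + ᾱ₁F⁻¹ + ᾱ₃F⁻²)` (Kosters–Pannekoek class `(ᾱ₁, ᾱ₃) ∈ 𝔽₂²` of the minimal model); `ζ := χ(2) = χ(σ₂)`,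
coefficients `ℤ[ζ]`; odd-order roots of unity reduce INJECTIVELY mod `2` (`X^d − 1` is separable over `𝔽₂` for odd
`d`), so `ζ̄ ≠ 1` iff `ζ ≠ 1`, `ord ζ̄ = ord ζ`, and `1 − μ` is a `2`-adic unit for every root of unity `μ ≠ 1` of odd
order). EQUIVARIANCE (used in (Q7)(ii)): `E` and `ω` are defined over `ℚ`, so `σ ∈ D` preserves `E₀(K_v)`, `M₀,v`,
the trace form and `R_v`, and `π_v(σ₂^j x) = F^j π_v(x)`; `P_v` is `F`-stable (`ᾱ₁, ᾱ₃ ∈ 𝔽₂`); `G` permutes the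
places above `2`, so "integral at every `v ∣ 2`" is `G`-stable. Resolvents: `R_ψ(x) := Σ_{b∈G} ψ(b)σ_b(x)` for
`x ∈ K`, `ψ ∈ Ĝ`; Fourier inversion `Σ_ψ ψ̄(b)R_ψ(x) = |G|·σ_b(x)` (characteristic `0`), so `x ↦ (R_ψ(x))_ψ` is
injective. THREE further steps:
(Q6) REALITY. Let `Z = Σ_j n_j·_{c,d}z_m(f, 1, 1, ξ_j, S)` (`ξ_j ∈ SL₂(ℤ)`, same `c, d, S`; the polar fact's item 1)
     be an integral combination whose Betti class `γ := Σ_j n_j δ(f, 1, ξ_j)` is `ι`-FIXED, and let `x = x_Z ∈ K` be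
     the `K`-coordinate of `exp*(loc Z) = f ⊗ x` (Thm. 9.7). For every ODD `ψ ∈ Ĝ` (any, also imprimitive — Thm.
     6.6 is stated for every character), Thm. 6.6 (1) with `± = ψ(−1) = −` reads
     `R_ψ(x)·per_f(f)⁻ = T_ψ·L_S(f*, ψ, 1)·γ⁻`, and `γ⁻ = ½(γ − ιγ) = 0` while `per_f(f)⁻ ≠ 0` (both `±`-parts of
     the period class of a cusp form are non-zero); hence `R_ψ(x) = 0` for all odd `ψ`. Put `y := x − σ_{−1}x`:
     `R_ψ(y) = (1 − ψ(−1))R_ψ(x)` vanishes for even `ψ` (factor `0`) and for odd `ψ` (`2R_ψ(x) = 0`), so `y = 0`: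
     `x ∈ K⁺ := K^{σ_{−1}}`. [Cross-check, not load-bearing: Thm. 12.5 (1) prints `z_{ι(γ)} = σ_{−1}(z_γ)`
     rationally; it holds integrally because `H¹(ℤ[1/S, ζ_m], T₂E)` is torsion-free — its torsion is
     `E(ℚ(ζ_m))[2^∞]`, and `E(ℚ(ζ_m))[2] = 0`: a root in the abelian field `ℚ(ζ_m)` of the IRREDUCIBLE `2`-division
     cubic would generate a cyclic cubic subfield of `ℚ(E[2]) ∩ ℚ(ζ_m)`, unramified outside `N∞` and outside `m`,
     hence trivial as `(m, 2N) = 1`.]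
(Q7) HALF-ORBIT POLAR INVISIBILITY. For `x ∈ K⁺ ∩ ∏_{v∣2} R_v` and `χ` as above (even, odd order, `χ(8) ≠ 1`, so
     `ζ ≠ 1` and `ord ζ ≠ 3`): `R_χ(x) = 2·H_χ(x)` with `H_χ(x) := Σ_{b∈G/±} χ(b)σ_b(x)` (well defined:
     `χ(−b)σ_{−b}x = χ(b)σ_bσ_{−1}x = χ(b)σ_b x`), and `H_χ(x)` is `2`-INTEGRAL. Proof.
     (i) `σ_{−1} ∉ D`: with `S` a transversal of `G/(±D)`, `⊔_{c∈S} cD` is a transversal of `G/±` (size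
     `|G|/(2f)·f`; `cd₁ = ±c′d₂ ⟹ c = c′, d₁ = ±d₂ ⟹ d₁ = d₂`), so `H_χ(x) = Σ_{c∈S} χ(c)σ_c(Θ_χ x)`,
     `Θ_χ := Σ_{i<f} ζ^iσ₂^i`, and `π_v(Θ_χ x) = Θ̄·π_v(x) = 0` at every `v` by the polar fact's (Q4) (`Θ̄ = Σ_{i<f} ζ̄^iF^i`
     kills `P_v ⊗ 𝔽₂[ζ̄]` when `ζ ≠ 1`, `ord ζ ≠ 3`): `Θ_χ x` is integral above `2`, hence so is each `σ_c(Θ_χ x)` and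
     `H_χ(x)` (reality of `x` not even used).
     (ii) `σ_{−1} ∈ D`: then `f` is even and `σ_{−1} = σ₂^{n}`, `n := f/2` (the unique involution of the cyclic `D`);
     `⊔_{c∈G/D} c·{σ₂^i : i < n}` is a transversal of `G/±` (size `(|G|/f)·n`; `cσ₂^i = ±c′σ₂^{i′}` forces `c = c′` and
     `i − i′ ∈ {0, n} + fℤ`, i.e. `i = i′`), so `H_χ(x) = Σ_{c∈G/D} χ(c)σ_c(Θ_half x)`, `Θ_half := Σ_{i<n} ζ^iσ₂^i`.
     Reality gives `π_v(x) = π_v(σ₂^{n}x) = F^{n}π_v(x)`, i.e. `π_v(x) ∈ P_v ∩ Fix(F^{n})`; and `ζ^{n} = χ(σ_{−1}) =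
     χ(−1) = 1`, `ζ̄ ≠ 1`. Two identities (in `ℤ[ζ]`, exact in characteristic `0` since `ζ^{n} = 1`, `ζ ≠ 1`; `ζ − 1`
     is a `2`-unit): `Σ_{i<n} ζ^i = (ζ^{n} − 1)/(ζ − 1) = 0` and `Σ_{i<n} iζ^i = n/(ζ − 1)`. Branch by K–P class:
     `(0,0)`: `P = 0`. `(1,0)`: `P = 𝔽₂`, `F = 1`, `Θ̄_half = Σ_{i<n} ζ̄^i = 0`. `(0,1)`: `P = 𝔽₄` (`f` even), `F = 1 + ν`
     on the basis `(1, ω)` with `ν² = 0`; `n` even ⟹ `Θ̄_half = Σζ̄^i + ν·Σ iζ̄^i = 0 + ν·n/(ζ̄ − 1) = 0` (`n ≡ 0` in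
     characteristic `2`); `n` odd ⟹ `Fix(F^{n}) ∩ 𝔽₄ = Fix(F) = 𝔽₂`, `F = 1` there, `Σζ̄^i = 0`. `(1,1)`: `P` = the plane
     of roots of `y³ + y + 1` (present iff `3 ∣ f`; then `6 ∣ f`, `3 ∣ n`, `F^{n} = 1` on `P ⊆ 𝔽₈`), `F|_P` has
     separable minimal polynomial `x² + x + 1`, eigenvalues `ω^{±1}` over `𝔽₂[ζ̄, ω]`; on the `ω^{±1}`-eigenline
     `Θ̄_half = Σ_{i<n} (ζ̄ω^{±1})^i = ((ζ̄ω^{±1})^{n} − 1)/(ζ̄ω^{±1} − 1) = 0`, because `(ζ̄ω^{±1})^{n} = 1` (`3 ∣ n`) and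
     `ζ̄ω^{±1} ≠ 1 ⟺ ord ζ ≠ 3 ⟸ χ(8) = ζ³ ≠ 1` (extension of scalars is faithful). Hence
     `π_v(Θ_half x) = Θ̄_half π_v(x) = 0` for all `v`, `Θ_half x` is integral above `2`, and `H_χ(x) ∈ ℤ̄₂`. Hypotheses
     used = exactly the polar fact's (`2 ∤ ord χ`, `χ(8) ≠ 1`, additive at `2`, `(m, 2N) = 1`) + reality of `x`. [If
     `P_v = 0` (no Kosters–Pannekoek pole) (Q7) is empty: `H_χ(x)` is a sum of integers.]
(Q8) BOOKKEEPING (uniform in the sign of `Δ`). Work in `H¹(E(ℂ), ·) = Hom(H₁(E(ℂ), ℤ), ·)`, `ι^*` = transpose of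
     `ι_*`, `[ω]⁺(x) = Re ∫_x ω` (the rational `ω`); `Ω₁ := ∫_{γ⁺_cyc} ω > 0` the least positive real period,
     `Ω(W) := ∫_{W(ℝ)}|ω| = #π₀(W(ℝ))·Ω₁`. RECTANGULAR (`Δ > 0`): `H₁ = ℤγ⁺ ⊕ ℤγ⁻`, `ι_* = diag(1, −1)`, dual basis
     `e^±`, `ι^*e^± = ±e^±`, primitive `ι^*`-fixed class `γ_ι = e⁺`, `[ω]⁺ = Ω₁e⁺ = (Ω(W)/2)·γ_ι`. RHOMBIC (`Δ < 0`):
     `H₁ = ℤγ⁺ ⊕ ℤη`, `ι_*η = γ⁺ − η`, `∫_η ω = (Ω₁ + iΩ₁⁻)/2`, `Ω(W) = Ω₁`; `ι^*`-fixed functionals satisfy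
     `e(γ⁺) = 2e(η)`, primitive `γ_ι`: `γ_ι(γ⁺) = 2`, `γ_ι(η) = 1`; `[ω]⁺(γ⁺) = Ω₁`, `[ω]⁺(η) = Ω₁/2`, so
     `[ω]⁺ = (Ω₁/2)·γ_ι = (Ω(W)/2)·γ_ι`. LATTICE: `H₁(W,ℤ) ⊗ ℤ₂ ≅ H₁(E₁,ℤ) ⊗ ℤ₂` `ι`-equivariantly (the isogeny
     `E₁ → W` from the `X₁(N)`-optimal curve has ODD degree, `W[2]` irreducible) and `H₁(E₁,ℤ) ⊆ V_ℤ(f)` (Wuthrich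
     §3), so `γ_ι` is an admissible integral index — this is the polar fact's item 1. VALUE (Thm. 6.6 (1), even `χ`,
     `+`, with the `ι`-fixed `γ = γ_ι = γ_ι⁺` of (Q6)): `R_χ(x_{γ_ι})·[ω]⁺ = T_χ·L_S·γ_ι`, i.e.
     `R_χ(x_{γ_ι}) = 2·T_χ·L_S(E, χ, 1)/Ω(W)` in BOTH shapes; by (Q6)+(Q7) `R_χ(x_{γ_ι}) = 2H_χ(x_{γ_ι})` with
     `H_χ ∈ ℤ̄₂`; hence `T_χ·L_S(E,χ,1)/Ω(W) ∈ ℤ̄₂`, and with the polar fact's item 4 (the unit `T_χ`, the symmetrised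
     Euler factor, `τ(χ)τ(χ̄) = ±m` odd, Birch's formula) the typed reading below — the polar fact's conclusion with the
     factor `((if 0 < V.Δ then 2 else 1 : ℕ) : ℂ)` DELETED. DICTIONARY with the polar fact: it evaluated the class `e`
     with `⟨e, γ⁺_cyc⟩ = 1` — rectangular `e = e⁺ = γ_ι` (the REAL element; a real element's even resolvent is twice a
     half-orbit sum: the loss), rhombic `e = u` with `e⁺ = ½γ_ι`, where the two statements coincide.
HENCE, the typed reading: for `V/ℚ` globally minimal with newform `f` at level `N`, ADDITIVE at `2`, `E[2]`
irreducible, `(m, 2N) = 1`, `χ` primitive mod `m`, `χ ≠ 1`, of odd order, with `χ(8) ≠ 1`, and `ϖ ∈ ℚ`, `r ∈ ℂ`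
with `ϖ·Ω(V) = Ω⁺_f` and `∏_{ℓ∥N}(ℓ − a_ℓχ(ℓ))(ℓ − a_ℓχ(ℓ)⁻¹)·Σ_aχ(a){∞,a/m}_f = r·Ω⁺_f`: `s·ϖ·r` is an algebraic
integer for some ODD `s ∈ ℕ`. NO Manin-constant, modular-degree, discriminant-sign or curve-side Kosters–Pannekoek
binder. Weaker than the derivation in every binder (the exclusion `χ(8) ≠ 1` and primitivity are kept even where
(Q4)/(Q7) give more; `χ.IsPrimitive` is not used by (Q6)–(Q8) and is kept for sibling symmetry).

WHAT IS PRINT AND WHAT IS READING. Printed verbatim: everything listed above and in the polar fact. Non-verbatim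
(flag for the referee:
`Kato-(8.1.3)-9.7-6.6(both parities)-12.5(1)(σ₋₁)-KostersPannekoek-3.3.1-additive-two-twisted-Neron-reading-real`):
the polar fact's non-verbatim steps (its items 1, 3, 4 and (Q1)–(Q5); re-derived there by the vendoring seat and by
the cell's statement refuter, REFUTER-ref1 §R38) AND (Q6)–(Q8) above, which use only the STATEMENT of Thm. 6.6 (1)
at odd characters, Galois-equivariance of `exp*`/`loc`/`π_v`, two transversal counts and linear algebra over
`𝔽₂[ζ̄]`; (Q6)–(Q8) were written by the cell's analytic lens (MEMO-an §54.3, 2026-08-28T02:20Z), RE-DERIVED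
independently by the Euler-system lens as owner of the polar fact (MEMO-es §24.2–24.4, 02:46Z: two proofs of (Q6),
the branch table of (Q7) with the symbolic check HOME/es/E24-halftheta.py 6fa7f48cfb2b29f8 — 597 half-`Θ` triples
and 361 full-`Θ` pairs in `𝔽₂[X]/Φ_d`, 0 failures; the guard `χ(8) ≠ 1` is needed: class `(1,1)`, `ord ζ = 3`, `n`
odd fails 15/15 — and an A1–A6 read of the decl: 0 findings) and by the vendoring seat (cell typer g6, seat NOTES
«F-an-42 CHECK», 2026-08-28T03:0xZ: transversals, the five branches, the two `ℤ[ζ]` identities, torsion-freeness,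
odd isogeny degree); statement-refuter audit REFUTER-ref1 R-an-26 / R-es-24 and literature-placement audit
REFUTER-ref2 R-an-27 REQUESTED (pending at filing; a finding is repaired under a new name, never in place). NOT in
print as a statement (nearest print: Bullach–Honnor Thm. 2.8 (b), the `c_∞`-weighted integral CLASS at odd `p`;
Wuthrich 2014 §3, odd semistable `p`). Consistency: this statement ⟹ the polar fact (proved bridge); at Manin
constant `1` it reads «`e_S(χ)·Σ_{a∈G}χ(a)x_f(a)/2` is an algebraic integer», identically true since
`x_f(−a) = x_f(a)` makes the full sum twice a half sum of integers — so, like the polar fact, it is not refutable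
by modular-symbol data; its census content is SHARPNESS (cell census E19A: all 1061 `E[2]`-irreducible optimal
curves with `4 ∣ N ≤ 2000`, among them all 147 with `Δ > 0`, have some admissible `χ` with an odd normalised value)
and its consequence «lattice-optimal, `4 ∣ N`, `W[2]` irreducible ⟹ Manin constant odd» is refutable by ONE curve
(Cremona: constant `1` on all 897 670 optimal classes with `4 ∣ N < 5·10⁵`, table
HOME/MANIN-ADDITIVE-CREMONA-TIER-v1.tsv.gz of the cell). No `_holds` (size XL: Kato's explicit reciprocity law).

## References

* K. Kato, Astérisque 295 (2004): §4.5 (p. 144), §4.7 (p. 145), Thm. 6.6 (p. 163), (8.1.2)–(8.1.3) (p. 180),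
  Thm. 9.7 (p. 189), Thm. 12.5 (1) (p. 221), Thm. 12.4 (3) / 12.5 (4) / 12.6 (2) (pp. 221–222), remark after
  (12.8.1) (p. 223). [Kato2004Asterisque]
* M. Kosters, R. Pannekoek, arXiv:1703.07888 (2017): Thm. 1 (i), Cor. 2 (i), Lemma 7, Lemma 9, Prop. 10, §3.3.1
  (table, `p = 2`), Example 13. [KostersPannekoek2017]
* C. Wuthrich, Doc. Math. 19 (2014): §3. [Wuthrich2014]
* D. Bullach, M. Honnor, arXiv:2511.07203 (2025): §2.1, Rem. 2.1, Thm. 2.8 (b)(c). [BullachHonnor2025]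
* C.-H. Kim, K. Nakamura, J. Number Theory 210 (2020): §2.1, Cor. 2.4. [KimNakamura2020]
* D. Delbourgo, J. Number Theory 95 (2002): §1, p. 50. [Delbourgo2002]
* S. Bloch, K. Kato, The Grothendieck Festschrift I (1990): §3. [BlochKato1990]
* B. Mazur, J. Tate, J. Teitelbaum, Invent. Math. 84 (1986): §I.8 (8.6). [MazurTateTeitelbaum1986]
-/

noncomputable section

open scoped MatrixGroups ModularForm Classical

open CongruenceSubgroup Literature.NumberTheory.EllipticCurves.ModularForms

namespace Literature.NumberTheory.EllipticCurves

/-- **Kato's Euler system read in Néron units at the ADDITIVE prime `2` with `E[2]` irreducible, for every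
primitive Dirichlet character `χ` of ODD order, conductor `m` prime to `2N`, with `χ(8) ≠ 1`: the symmetrised
`N`-imprimitive Birch–Manin twisted value is `2`-integral against the FULL real Néron period
`Ω(V) = ∫_{V(ℝ)}|ω|`** — the binders of `kato_neron_isIntegral_twistedSymbolSum_of_additive_two_polar` VERBATIM,
its conclusion WITHOUT the factor `#π₀(V(ℝ)) = (if 0 < Δ(V) then 2 else 1)` (that fact is the special case: proved
bridge `kato_neron_isIntegral_twistedSymbolSum_of_additive_two_polar_of_real`). A derived reading (weaker than the
derivation, never stronger) of: K. Kato, Astérisque 295 (2004), **(8.1.3)** (p. 180), **Thm. 9.7** (p. 189),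
**Thm. 6.6 (1)** (p. 163: "Let `χ : (ℤ/m)^× → ℂ^×` be a character" — of either parity —, `± = (−1)^{k−r−1}χ(−1)`,
`T = (c² − c^uχ̄(c))(d² − d^vχ̄(d))` for `ξ ∈ SL₂(ℤ)`, `c ≡ d ≡ 1 mod N`), **§4.5** (p. 144: `ι` induced by complex
conjugation, `x^± = ½(x ± ι(x))`), **Thm. 12.5 (1)** (p. 221: "`z_{ι(γ)} = σ_{−1}(z_γ)` for all `γ`", cross-check
only), **Thm. 12.6 (2)** (p. 222), the remark after **(12.8.1)** (p. 223) — and NOT Thm. 12.4 (3) / 12.5 (4) ("`p ≠ 2`");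
M. Kosters, R. Pannekoek, arXiv:1703.07888, **Thm. 1 (i)**, **Cor. 2 (i)**, **Prop. 10** (`p = 2` clause), the
**§3.3.1 table, `p = 2`**; C. Wuthrich, Doc. Math. 19 (2014) §3 ("`V_ℤ(f)` … contains the lattice `H₁(E₁(ℂ), ℤ)`");
the duality identity (Delbourgo 2002 p. 50; Bloch–Kato 1990 §3; Kim–Nakamura 2020 p. 5 / Cor. 2.4 — mechanism
only); Birch's formula (Mazur–Tate–Teitelbaum 1986 (I.8.6)). DERIVATION = the polar fact's items 1, 3, 4 and its
receptacle computation (Q1)–(Q5) at `2` (module docstring of `KatoAdditiveTwistedValueNeronIntegralityTwo.lean`),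
PLUS: (Q6) REALITY — for an integral combination `Z` of the `(c,d)`-elements whose Betti class `γ` is `ι`-fixed,
the odd-character clause of Thm. 6.6 (1) gives `R_ψ(x_Z)·per_f(f)⁻ = T_ψ·L_S·γ⁻ = 0` for EVERY odd `ψ`, hence (Fourier
inversion on `K = ℚ(ζ_m)`) `x_Z ∈ K⁺`; (Q7) HALF-ORBIT POLAR INVISIBILITY — for `x ∈ K⁺ ∩ ∏_{v∣2} R_v` and `χ`
even of odd order with `χ(8) ≠ 1`, `R_χ(x) = 2H_χ(x)`, `H_χ(x) = Σ_{b∈G/±}χ(b)σ_b(x)`, and `H_χ(x)` is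
`2`-integral: with `D = ⟨σ₂⟩` the decomposition group at every `v ∣ 2` (order `f`, `m` odd), `ζ = χ(2)`: if
`σ_{−1} ∉ D`, `H_χ(x) = Σ_c χ(c)σ_c(Θ_χ x)` over a transversal of `G/(±D)` and `Θ̄ = Σ_{i<f}ζ̄^iF^i` kills the polar
part by (Q4); if `σ_{−1} = σ₂^{n} ∈ D` (`f = 2n`), `H_χ(x) = Σ_{c∈G/D} χ(c)σ_c(Θ_half x)`, `Θ_half = Σ_{i<n}ζ^iσ₂^i`,
reality puts `π_v(x)` in `P_v ∩ Fix(F^{n})`, `ζ^{n} = χ(−1) = 1 ≠ ζ`, and `Θ̄_half` kills `P_v ∩ Fix(F^{n})` in every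
Kosters–Pannekoek class — `(1,0)`: `Σ_{i<n}ζ̄^i = 0`; `(0,1)`, `n` even: `Σζ̄^i + ν·n/(ζ̄ − 1) = 0`; `(0,1)`, `n` odd:
`Fix(F) ∩ 𝔽₄ = 𝔽₂`, `Σζ̄^i = 0`; `(1,1)` (`3 ∣ n`): `Σ_{i<n}(ζ̄ω^{±1})^i = 0` as `(ζ̄ω^{±1})^{n} = 1` and `ζ̄ω^{±1} ≠ 1 ⟸
χ(8) ≠ 1`; `(0,0)`: nothing to do; (Q8) BOOKKEEPING — for the primitive `ι`-fixed integral class `γ_ι`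
(admissible: `H₁(W,ℤ)⊗ℤ₂ ≅ H₁(E₁,ℤ)⊗ℤ₂ ⊆ V_ℤ(f)⊗ℤ₂`, odd isogeny degree, Wuthrich §3) one has
`[ω]⁺ = (Ω(W)/2)·γ_ι` in BOTH lattice shapes (rectangular `γ_ι = e⁺`, `Ω(W) = 2Ω₁`; rhombic `γ_ι = 2u + v`,
`Ω(W) = Ω₁`), so Thm. 6.6 (1) at even `χ` gives `R_χ(x_{γ_ι}) = 2·T_χ·L_S(E,χ,1)/Ω(W) = 2H_χ(x_{γ_ι})` with
`H_χ ∈ ℤ̄₂`, i.e. `T_χ·L_S(E,χ,1)/Ω(W) ∈ ℤ̄₂` for both signs of `Δ`. HENCE: for `V/ℚ` globally minimal with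
newform `f` at level `N`, additive at `2`, `E[2]` irreducible, `(m, 2N) = 1`, `χ` primitive mod `m`, `χ ≠ 1`,
`2 ∤ ord χ`, `χ(8) ≠ 1`, `ϖ ∈ ℚ`, `r ∈ ℂ` with `ϖ·Ω(V) = Ω⁺_f` and
`∏_{ℓ∥N}(ℓ − a_ℓχ(ℓ))(ℓ − a_ℓχ(ℓ)⁻¹)·Σ_aχ(a){∞,a/m}_f = r·Ω⁺_f`: `s·ϖ·r` is an algebraic integer for some `s ∈ ℕ`
with `2 ∤ s`. Flag for the referee:
`Kato-(8.1.3)-9.7-6.6(both parities)-12.5(1)(σ₋₁)-KostersPannekoek-3.3.1-additive-two-twisted-Neron-reading-real`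
(non-verbatim steps: the polar fact's, re-derived there and audited REFUTER-ref1 §R38, and (Q6)–(Q8), written
out in the module docstring — cell MEMO-an §54.3, re-derived by the owner of the polar fact MEMO-es §24 with the
symbolic check E24 (958 cases, 0 failures) and by the vendoring seat; statement-refuter audit REFUTER-ref1
R-an-26 / R-es-24 and placement audit REFUTER-ref2 R-an-27 requested; not in print as a statement — nearest print
Bullach–Honnor arXiv:2511.07203 Thm. 2.8 (b), the `c_∞`-weighted integral class at odd `p`). No `_holds` (size XL).
[cite: Kato2004Asterisque, §4.5 (p. 144), Thm. 6.6 (1) (p. 163), (8.1.3) (p. 180), Thm. 9.7 (p. 189), Thm. 12.5 (1) (p. 221), Thm. 12.6 (2) (p. 222), remark after (12.8.1) (p. 223)]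
[cite: KostersPannekoek2017, Thm. 1 (i), Cor. 2 (i), Lemma 7, Prop. 10, §3.3.1 (table p = 2), Example 13]
[cite: Wuthrich2014, §3] [cite: BullachHonnor2025, §2.1, Rem. 2.1, Thm. 2.8 (b)(c) (nearest print, placement only)]
[cite: KimNakamura2020, §2.1 (perfect pairing) and Cor. 2.4] [cite: Delbourgo2002, p. 50 (duality identity), §1]
[cite: BlochKato1990, §3 (Prop. 3.8, Def. 3.10, (3.11))] [cite: MazurTateTeitelbaum1986, §I.8 (8.6)] -/
def kato_neron_isIntegral_twistedSymbolSum_of_additive_two_real : Prop :=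
  ∀ (V : WeierstrassCurve ℚ) [V.IsElliptic] [V.IsGloballyMinimal] {N : ℕ} [NeZero N]
    (f : CuspForm (Gamma0 N) 2) (_ : IsNewformOf V f)
    (_ : ¬ V.HasGoodReductionAtPrime 2) (_ : ¬ V.HasMultiplicativeReductionAtPrime 2)
    (_ : V.HasIrreducibleModPGaloisRep 2) (m : ℕ) [NeZero m] (_ : m.Coprime (2 * N))
    (χ : DirichletCharacter ℂ m) (_ : χ.IsPrimitive) (_ : χ ≠ 1) (_ : ¬ 2 ∣ orderOf χ)
    (_ : χ (8 : ZMod m) ≠ 1) (ϖ : ℚ) (r : ℂ),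
    (ϖ : ℝ) * V.realPeriodRat = plusPeriod f →
      (∏ ℓ ∈ N.primeFactors with ¬ ℓ ^ 2 ∣ N,
          (((ℓ : ℂ) - (V.LFunction ℓ : ℂ) * χ (ℓ : ZMod m)) *
            ((ℓ : ℂ) - (V.LFunction ℓ : ℂ) * (χ (ℓ : ZMod m))⁻¹))) *
          twistedSymbolSum f χ = r * (plusPeriod f : ℂ) →
      ∃ s : ℕ, ¬ 2 ∣ s ∧ IsIntegral ℤ ((s : ℂ) * ϖ * r)

end Literature.NumberTheory.EllipticCurves

end
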